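import Literature.NumberTheory.IwasawaTheory.ClassicalMuVanishesUnitNormIndexTwoNonNormUnits
import Literature.NumberTheory.IwasawaTheory.CyclotomicTwoTotallyRamifiedOddIndex
import HarnessLib

/-!
# The `p = 2` unit-norm-index doors for an odd-degree field of ODD DISCRIMINANT, Fukuda's index discharged:
# two (resp. one) explicit non-norm units at ONE layer ⟹ `e_m` constant from that layer on, `μ₂ = 0`, `λ₂ = 0`

Topic `NumberTheory/IwasawaTheory` (namespace = path).  THEOREMS ONLY (no definition, no named fact, no instance, no `sorry`);
unconditional.  For a number field `K` of odd degree with `2 ∤ d_K` every cyclotomic `ℤ₂`-extension has Fukuda's index `0`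
(`totallyRamifiedFrom_zero_of_not_dvd_discr`, tree), so the hypothesis `hram : TotallyRamifiedFrom κ n₀` / `hn : n₀ ≤ n` of the doors of
`ClassicalMuVanishesUnitNormIndexTwoNonNormUnits.lean` disappears: what is left is data of ONE layer `K_{n+1}/K_n` — at most three
(resp. two) ramified primes, the classes of the ramified primes generating `Cl(K_n)` modulo squares, and two (resp. one) units of `K_n`
outside `N K_{n+1}ˣ` (kernel-decidable dyadic residues, `NumberFields/QuadraticNonNormUnitDyadicIdeal.lean`).

* door U (`n = 0`, `2 ∤ h_K`): `classNumberPExp_eq_zero_two_of_two_nonNorm_units_of_not_dvd_discr` (≤ 3 primes above `2`) and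
  `…_of_nonNorm_unit_of_not_dvd_discr` (≤ 2 primes): `e_n = 0` for all `n`; `classicalMuVanishes_…` forms.
* door UG (layer `K_{n+1}/K_n`, any `h`): `classNumberPExp_eq_of_le_two_of_two_nonNorm_units_of_sup_eq_top_of_not_dvd_discr`
  (`e_m = e_n` for all `m ≥ n`), `classicalMuVanishes_two_of_two_nonNorm_units_of_sup_eq_top_of_not_dvd_discr` (`μ₂ = 0`),
  `classicalLambda_eq_zero_two_of_two_nonNorm_units_of_sup_eq_top_of_not_dvd_discr` (`λ₂ = 0`).

For a cubic field `F` in which `2` splits completely (`d_F ≡ 1 (mod 8)`, three dyadic primes at every layer, `e_1 ≥ e_0 + 1`) the door UG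
at `n = 1` is the certificate: `Cl(F(√2))/2` generated by the three dyadic primes of `F(√2)`, two units of `F(√2)` with the three non-norm
conditions — output `e_m = e_1` for all `m ≥ 1`, `μ₂ = λ₂ = 0`.  HONEST SCOPE: packaging of tree theorems; nothing specific to any summit;
BSD is not advanced by this file.

## References

* T. Fukuda, *Remarks on `ℤ_p`-extensions of number fields*, Proc. Japan Acad. 70 A (1994), Thm. 1 (1), p. 264. [Fukuda1994]
* L. C. Washington, *Introduction to Cyclotomic Fields*, 2nd ed., GTM 83 (1997), §13.1 Lemma 13.3, Prop. 13.2. [Washington1997]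
* S. Lang, *Cyclotomic Fields I and II*, GTM 121 (1990), Ch. 13 §4, Lemma 4.1–4.2. [Lang1990]
-/

noncomputable section

open NumberField IsDedekindDomain
open scoped nonZeroDivisors

namespace Literature.NumberTheory.IwasawaTheory

open Literature.NumberTheory.EllipticCurves Literature.NumberTheory.NumberFields
  Literature.NumberTheory.NumberFields.AmbiguousClass
  Literature.NumberTheory.GaloisRepresentations Literature.NumberTheory.GaloisRepresentations.Herbrand
  Literature.NumberTheory.GaloisRepresentations.MinkowskiUnit
  Literature.NumberTheory.GaloisRepresentations.CyclicNormIndex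

variable {K : Type} [Field K] [NumberField K]

/-! ## §1 Door U for an odd-degree field of odd discriminant -/

/-- **Door U at `2`, odd discriminant, two non-norm units: `e_n = 0` for all `n`.**  `K` of odd degree with `2 ∤ d_K` and `2 ∤ h_K`, at
most three primes above `2`, `κ` a cyclotomic `ℤ₂`-extension, units `x, y` of `K` with `x`, `y`, `xy ∉ N K₁ˣ`: `ord₂ h(K_n) = 0` for every
`n` (Fukuda's index `0` by `totallyRamifiedFrom_zero_of_not_dvd_discr`; then `classNumberPExp_eq_zero_two_of_two_nonNorm_units`).  E.g. a
totally real cubic field of odd class number in which `2` splits completely, two units with `2`-adic residues `±3 (mod 8)` at suitable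
split primes. [cite: Fukuda1994, Thm. 1 (1), p. 264] [cite: Washington1997, §13.1 Lemma 13.3] [cite: Lang1990, Ch. 13 §4, Lemma 4.1–4.2] -/
theorem classNumberPExp_eq_zero_two_of_two_nonNorm_units_of_not_dvd_discr (hK2 : ¬ 2 ∣ Module.finrank ℚ K)
    (hd : ¬ (2 : ℤ) ∣ NumberField.discr K) (κ : ZpExtension K 2) (hκ : κ.IsCyclotomic) [FiniteDimensional K (κ.layer 1)]
    (hK : ¬ 2 ∣ classNumber K) (hs : {v : HeightOneSpectrum (𝓞 K) | ((2 : ℕ) : 𝓞 K) ∈ v.asIdeal}.ncard ≤ 3)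
    {x y : (κ.layer 1)ˣ} (hxE : x ∈ unitsE (κ.layer 1) ⊓ (unitsIncl K (κ.layer 1)).range)
    (hyE : y ∈ unitsE (κ.layer 1) ⊓ (unitsIncl K (κ.layer 1)).range)
    (hxN : x ∉ (⊤ : Subgroup (κ.layer 1)ˣ).map (Herbrand.norm (κ.layer 1 ≃ₐ[K] κ.layer 1)))
    (hyN : y ∉ (⊤ : Subgroup (κ.layer 1)ˣ).map (Herbrand.norm (κ.layer 1 ≃ₐ[K] κ.layer 1)))
    (hxyN : x * y ∉ (⊤ : Subgroup (κ.layer 1)ˣ).map (Herbrand.norm (κ.layer 1 ≃ₐ[K] κ.layer 1))) (n : ℕ) :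
    classNumberPExp κ n = 0 :=
  classNumberPExp_eq_zero_two_of_two_nonNorm_units κ (totallyRamifiedFrom_zero_of_not_dvd_discr hK2 hd κ hκ) hK hs
    hxE hyE hxN hyN hxyN n

/-- Corollary (growth form): under the same hypotheses `μ₂ = 0` (`λ = ν = 0`), i.e. `ClassicalMuVanishes κ`.
[cite: Fukuda1994, Thm. 1 (1), p. 264] -/
theorem classicalMuVanishes_two_of_two_nonNorm_units_of_not_dvd_discr (hK2 : ¬ 2 ∣ Module.finrank ℚ K)
    (hd : ¬ (2 : ℤ) ∣ NumberField.discr K) (κ : ZpExtension K 2) (hκ : κ.IsCyclotomic) [FiniteDimensional K (κ.layer 1)]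
    (hK : ¬ 2 ∣ classNumber K) (hs : {v : HeightOneSpectrum (𝓞 K) | ((2 : ℕ) : 𝓞 K) ∈ v.asIdeal}.ncard ≤ 3)
    {x y : (κ.layer 1)ˣ} (hxE : x ∈ unitsE (κ.layer 1) ⊓ (unitsIncl K (κ.layer 1)).range)
    (hyE : y ∈ unitsE (κ.layer 1) ⊓ (unitsIncl K (κ.layer 1)).range)
    (hxN : x ∉ (⊤ : Subgroup (κ.layer 1)ˣ).map (Herbrand.norm (κ.layer 1 ≃ₐ[K] κ.layer 1)))
    (hyN : y ∉ (⊤ : Subgroup (κ.layer 1)ˣ).map (Herbrand.norm (κ.layer 1 ≃ₐ[K] κ.layer 1)))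
    (hxyN : x * y ∉ (⊤ : Subgroup (κ.layer 1)ˣ).map (Herbrand.norm (κ.layer 1 ≃ₐ[K] κ.layer 1))) :
    ClassicalMuVanishes κ :=
  classicalMuVanishes_two_of_two_nonNorm_units κ (totallyRamifiedFrom_zero_of_not_dvd_discr hK2 hd κ hκ) hK hs
    hxE hyE hxN hyN hxyN

/-- **Door U at `2`, odd discriminant, one non-norm unit: `e_n = 0` for all `n`** (at most two primes above `2`; e.g. a cubic field of odd
class number with `2 = 𝔭₁𝔭₂` and a unit `≡ ±3 (mod 8)` under `K ↪ ℚ₂`). [cite: Fukuda1994, Thm. 1 (1), p. 264]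
[cite: Washington1997, §13.1 Lemma 13.3] [cite: Lang1990, Ch. 13 §4, Lemma 4.1–4.2] -/
theorem classNumberPExp_eq_zero_two_of_nonNorm_unit_of_not_dvd_discr (hK2 : ¬ 2 ∣ Module.finrank ℚ K)
    (hd : ¬ (2 : ℤ) ∣ NumberField.discr K) (κ : ZpExtension K 2) (hκ : κ.IsCyclotomic) [FiniteDimensional K (κ.layer 1)]
    (hK : ¬ 2 ∣ classNumber K) (hs : {v : HeightOneSpectrum (𝓞 K) | ((2 : ℕ) : 𝓞 K) ∈ v.asIdeal}.ncard ≤ 2)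
    {x : (κ.layer 1)ˣ} (hxE : x ∈ unitsE (κ.layer 1) ⊓ (unitsIncl K (κ.layer 1)).range)
    (hxN : x ∉ (⊤ : Subgroup (κ.layer 1)ˣ).map (Herbrand.norm (κ.layer 1 ≃ₐ[K] κ.layer 1))) (n : ℕ) :
    classNumberPExp κ n = 0 :=
  classNumberPExp_eq_zero_two_of_nonNorm_unit κ (totallyRamifiedFrom_zero_of_not_dvd_discr hK2 hd κ hκ) hK hs hxE hxN n

/-- Corollary (growth form, one unit): `ClassicalMuVanishes κ`. [cite: Fukuda1994, Thm. 1 (1), p. 264] -/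
theorem classicalMuVanishes_two_of_nonNorm_unit_of_not_dvd_discr (hK2 : ¬ 2 ∣ Module.finrank ℚ K)
    (hd : ¬ (2 : ℤ) ∣ NumberField.discr K) (κ : ZpExtension K 2) (hκ : κ.IsCyclotomic) [FiniteDimensional K (κ.layer 1)]
    (hK : ¬ 2 ∣ classNumber K) (hs : {v : HeightOneSpectrum (𝓞 K) | ((2 : ℕ) : 𝓞 K) ∈ v.asIdeal}.ncard ≤ 2)
    {x : (κ.layer 1)ˣ} (hxE : x ∈ unitsE (κ.layer 1) ⊓ (unitsIncl K (κ.layer 1)).range)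
    (hxN : x ∉ (⊤ : Subgroup (κ.layer 1)ˣ).map (Herbrand.norm (κ.layer 1 ≃ₐ[K] κ.layer 1))) :
    ClassicalMuVanishes κ :=
  classicalMuVanishes_two_of_nonNorm_unit κ (totallyRamifiedFrom_zero_of_not_dvd_discr hK2 hd κ hκ) hK hs hxE hxN

/-! ## §2 Door UG at a layer `K_{n+1}/K_n` for an odd-degree field of odd discriminant -/

section Layer

variable (κ : ZpExtension K 2) (n : ℕ) [NumberField (κ.layer n)] [Algebra (κ.layer n) (κ.layer (n + 1))]
  [IsScalarTower K (κ.layer n) (κ.layer (n + 1))]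
  [FiniteDimensional K (κ.layer (n + 1))] [FiniteDimensional (κ.layer n) (κ.layer (n + 1))]

/-- **Door UG at `2`, odd discriminant, two non-norm units: `e_m = e_n` for all `m ≥ n`.**  `K` of odd degree with `2 ∤ d_K`, `κ` a
cyclotomic `ℤ₂`-extension, a layer `K_{n+1}/K_n` (a `K_n`-algebra compatibly with `K`) with at most three ramified primes, units
`x, y` of `K_n` with `x`, `y`, `xy ∉ N K_{n+1}ˣ`, and the classes of the ramified primes generating `Cl(K_n)` modulo squares: the
`2`-class numbers are constant from `K_n` on (Fukuda's index `0` by `totallyRamifiedFrom_zero_of_not_dvd_discr`, then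
`classNumberPExp_eq_of_le_two_of_two_nonNorm_units_of_sup_eq_top`).  At `n = 1` for a cubic field with `2` totally split this is the
SEXTIC certificate replacing the class number of the degree-`12` layer. [folklore] [cite: Fukuda1994, Thm. 1 (1), p. 264]
[cite: Washington1997, §13.1 Lemma 13.3] [cite: Lang1990, Ch. 13 §4, Lemma 4.1–4.2 and sequel] -/
theorem classNumberPExp_eq_of_le_two_of_two_nonNorm_units_of_sup_eq_top_of_not_dvd_discr
    (hK2 : ¬ 2 ∣ Module.finrank ℚ K) (hd : ¬ (2 : ℤ) ∣ NumberField.discr K) (hκ : κ.IsCyclotomic)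
    (hs : {w : HeightOneSpectrum (𝓞 (κ.layer n)) |
        w.asIdeal.ramificationIdxIn (𝓞 (κ.layer (n + 1))) ≠ 1}.ncard ≤ 3) {x y : (κ.layer (n + 1))ˣ}
    (hxE : x ∈ unitsE (κ.layer (n + 1)) ⊓ (unitsIncl (κ.layer n) (κ.layer (n + 1))).range)
    (hyE : y ∈ unitsE (κ.layer (n + 1)) ⊓ (unitsIncl (κ.layer n) (κ.layer (n + 1))).range)
    (hxN : x ∉ (⊤ : Subgroup (κ.layer (n + 1))ˣ).map
        (Herbrand.norm (κ.layer (n + 1) ≃ₐ[κ.layer n] κ.layer (n + 1))))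
    (hyN : y ∉ (⊤ : Subgroup (κ.layer (n + 1))ˣ).map
        (Herbrand.norm (κ.layer (n + 1) ≃ₐ[κ.layer n] κ.layer (n + 1))))
    (hxyN : x * y ∉ (⊤ : Subgroup (κ.layer (n + 1))ˣ).map
        (Herbrand.norm (κ.layer (n + 1) ≃ₐ[κ.layer n] κ.layer (n + 1))))
    (hgen : Subgroup.closure {c : ClassGroup (𝓞 (κ.layer n)) |
        ∃ w : HeightOneSpectrum (𝓞 (κ.layer n)),
          w.asIdeal.ramificationIdxIn (𝓞 (κ.layer (n + 1))) ≠ 1 ∧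
            c = ClassGroup.mk0 ⟨w.asIdeal, mem_nonZeroDivisors_of_ne_zero w.ne_bot⟩} ⊔
      (powMonoidHom 2 : ClassGroup (𝓞 (κ.layer n)) →* ClassGroup (𝓞 (κ.layer n))).range = ⊤)
    {m : ℕ} (hm : n ≤ m) : classNumberPExp κ m = classNumberPExp κ n :=
  classNumberPExp_eq_of_le_two_of_two_nonNorm_units_of_sup_eq_top κ n
    (totallyRamifiedFrom_zero_of_not_dvd_discr hK2 hd κ hκ) (Nat.zero_le n) hs hxE hyE hxN hyN hxyN hgen hm

/-- **Door UG at `2`, odd discriminant, two non-norm units: `μ₂ = 0`** (growth form, `λ = 0`, `ν = e_n`). [folklore]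
[cite: Fukuda1994, Thm. 1 (1), p. 264] [cite: Lang1990, Ch. 13 §4, Lemma 4.1–4.2 and sequel] -/
theorem classicalMuVanishes_two_of_two_nonNorm_units_of_sup_eq_top_of_not_dvd_discr
    (hK2 : ¬ 2 ∣ Module.finrank ℚ K) (hd : ¬ (2 : ℤ) ∣ NumberField.discr K) (hκ : κ.IsCyclotomic)
    (hs : {w : HeightOneSpectrum (𝓞 (κ.layer n)) |
        w.asIdeal.ramificationIdxIn (𝓞 (κ.layer (n + 1))) ≠ 1}.ncard ≤ 3) {x y : (κ.layer (n + 1))ˣ}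
    (hxE : x ∈ unitsE (κ.layer (n + 1)) ⊓ (unitsIncl (κ.layer n) (κ.layer (n + 1))).range)
    (hyE : y ∈ unitsE (κ.layer (n + 1)) ⊓ (unitsIncl (κ.layer n) (κ.layer (n + 1))).range)
    (hxN : x ∉ (⊤ : Subgroup (κ.layer (n + 1))ˣ).map
        (Herbrand.norm (κ.layer (n + 1) ≃ₐ[κ.layer n] κ.layer (n + 1))))
    (hyN : y ∉ (⊤ : Subgroup (κ.layer (n + 1))ˣ).map
        (Herbrand.norm (κ.layer (n + 1) ≃ₐ[κ.layer n] κ.layer (n + 1))))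
    (hxyN : x * y ∉ (⊤ : Subgroup (κ.layer (n + 1))ˣ).map
        (Herbrand.norm (κ.layer (n + 1) ≃ₐ[κ.layer n] κ.layer (n + 1))))
    (hgen : Subgroup.closure {c : ClassGroup (𝓞 (κ.layer n)) |
        ∃ w : HeightOneSpectrum (𝓞 (κ.layer n)),
          w.asIdeal.ramificationIdxIn (𝓞 (κ.layer (n + 1))) ≠ 1 ∧
            c = ClassGroup.mk0 ⟨w.asIdeal, mem_nonZeroDivisors_of_ne_zero w.ne_bot⟩} ⊔
      (powMonoidHom 2 : ClassGroup (𝓞 (κ.layer n)) →* ClassGroup (𝓞 (κ.layer n))).range = ⊤) :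
    ClassicalMuVanishes κ :=
  classicalMuVanishes_two_of_two_nonNorm_units_of_sup_eq_top κ n
    (totallyRamifiedFrom_zero_of_not_dvd_discr hK2 hd κ hκ) (Nat.zero_le n) hs hxE hyE hxN hyN hxyN hgen

/-- **Door UG at `2`, odd discriminant, two non-norm units: `λ₂ = 0`** (`classicalLambda κ = 0`). [folklore]
[cite: Fukuda1994, Thm. 1 (1), p. 264 («μ_p(K/k) = λ_p(K/k) = 0»)] -/
theorem classicalLambda_eq_zero_two_of_two_nonNorm_units_of_sup_eq_top_of_not_dvd_discr
    (hK2 : ¬ 2 ∣ Module.finrank ℚ K) (hd : ¬ (2 : ℤ) ∣ NumberField.discr K) (hκ : κ.IsCyclotomic)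
    (hs : {w : HeightOneSpectrum (𝓞 (κ.layer n)) |
        w.asIdeal.ramificationIdxIn (𝓞 (κ.layer (n + 1))) ≠ 1}.ncard ≤ 3) {x y : (κ.layer (n + 1))ˣ}
    (hxE : x ∈ unitsE (κ.layer (n + 1)) ⊓ (unitsIncl (κ.layer n) (κ.layer (n + 1))).range)
    (hyE : y ∈ unitsE (κ.layer (n + 1)) ⊓ (unitsIncl (κ.layer n) (κ.layer (n + 1))).range)
    (hxN : x ∉ (⊤ : Subgroup (κ.layer (n + 1))ˣ).map
        (Herbrand.norm (κ.layer (n + 1) ≃ₐ[κ.layer n] κ.layer (n + 1))))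
    (hyN : y ∉ (⊤ : Subgroup (κ.layer (n + 1))ˣ).map
        (Herbrand.norm (κ.layer (n + 1) ≃ₐ[κ.layer n] κ.layer (n + 1))))
    (hxyN : x * y ∉ (⊤ : Subgroup (κ.layer (n + 1))ˣ).map
        (Herbrand.norm (κ.layer (n + 1) ≃ₐ[κ.layer n] κ.layer (n + 1))))
    (hgen : Subgroup.closure {c : ClassGroup (𝓞 (κ.layer n)) |
        ∃ w : HeightOneSpectrum (𝓞 (κ.layer n)),
          w.asIdeal.ramificationIdxIn (𝓞 (κ.layer (n + 1))) ≠ 1 ∧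
            c = ClassGroup.mk0 ⟨w.asIdeal, mem_nonZeroDivisors_of_ne_zero w.ne_bot⟩} ⊔
      (powMonoidHom 2 : ClassGroup (𝓞 (κ.layer n)) →* ClassGroup (𝓞 (κ.layer n))).range = ⊤) :
    classicalLambda κ = 0 :=
  classicalLambda_eq_zero_two_of_two_nonNorm_units_of_sup_eq_top κ n
    (totallyRamifiedFrom_zero_of_not_dvd_discr hK2 hd κ hκ) (Nat.zero_le n) hs hxE hyE hxN hyN hxyN hgen

end Layer

/-! ## §3 Door UG with ONE non-norm unit (at most two ramified primes) for an odd-degree field of odd discriminant -/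

section LayerOne

variable (κ : ZpExtension K 2) (n : ℕ) [NumberField (κ.layer n)] [Algebra (κ.layer n) (κ.layer (n + 1))]
  [IsScalarTower K (κ.layer n) (κ.layer (n + 1))]
  [FiniteDimensional K (κ.layer (n + 1))] [FiniteDimensional (κ.layer n) (κ.layer (n + 1))]

/-- **Door UG at `2`, odd discriminant, ONE non-norm unit: `e_m = e_n` for all `m ≥ n`.**  `K` of odd degree with `2 ∤ d_K`, `κ` a
cyclotomic `ℤ₂`-extension, a layer `K_{n+1}/K_n` with at most TWO ramified primes (e.g. the tower of a cubic field with `2 = 𝔭₁𝔭₂`), a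
unit `x` of `K_n` outside `N K_{n+1}ˣ`, and the classes of the ramified primes generating `Cl(K_n)` modulo squares: the `2`-class numbers
are constant from `K_n` on (Fukuda's index `0` by `totallyRamifiedFrom_zero_of_not_dvd_discr`; `classNumberPExp_succ_eq_two_of_nonNorm_unit_of_sup_eq_top`;
Fukuda's Thm. 1 (1), a tree theorem).  The `e_n`-tolerant companion of door U with one unit (`h(K)` may be even). [folklore]
[cite: Fukuda1994, Thm. 1 (1), p. 264] [cite: Washington1997, §13.1 Lemma 13.3] [cite: Lang1990, Ch. 13 §4, Lemma 4.1–4.2 and sequel] -/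
theorem classNumberPExp_eq_of_le_two_of_nonNorm_unit_of_sup_eq_top_of_not_dvd_discr
    (hK2 : ¬ 2 ∣ Module.finrank ℚ K) (hd : ¬ (2 : ℤ) ∣ NumberField.discr K) (hκ : κ.IsCyclotomic)
    (hs : {w : HeightOneSpectrum (𝓞 (κ.layer n)) |
        w.asIdeal.ramificationIdxIn (𝓞 (κ.layer (n + 1))) ≠ 1}.ncard ≤ 2) {x : (κ.layer (n + 1))ˣ}
    (hxE : x ∈ unitsE (κ.layer (n + 1)) ⊓ (unitsIncl (κ.layer n) (κ.layer (n + 1))).range)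
    (hxN : x ∉ (⊤ : Subgroup (κ.layer (n + 1))ˣ).map
        (Herbrand.norm (κ.layer (n + 1) ≃ₐ[κ.layer n] κ.layer (n + 1))))
    (hgen : Subgroup.closure {c : ClassGroup (𝓞 (κ.layer n)) |
        ∃ w : HeightOneSpectrum (𝓞 (κ.layer n)),
          w.asIdeal.ramificationIdxIn (𝓞 (κ.layer (n + 1))) ≠ 1 ∧
            c = ClassGroup.mk0 ⟨w.asIdeal, mem_nonZeroDivisors_of_ne_zero w.ne_bot⟩} ⊔
      (powMonoidHom 2 : ClassGroup (𝓞 (κ.layer n)) →* ClassGroup (𝓞 (κ.layer n))).range = ⊤)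
    {m : ℕ} (hm : n ≤ m) : classNumberPExp κ m = classNumberPExp κ n :=
  fukuda1994_thm1_classNumberPExp_const_of_succ_eq_holds K 2 κ 0 (totallyRamifiedFrom_zero_of_not_dvd_discr hK2 hd κ hκ) n
    (Nat.zero_le n) (classNumberPExp_succ_eq_two_of_nonNorm_unit_of_sup_eq_top κ n hs hxE hxN hgen) m hm

/-- **Door UG at `2`, odd discriminant, one non-norm unit: `μ₂ = 0`** (growth form, `λ = 0`, `ν = e_n`). [folklore]
[cite: Fukuda1994, Thm. 1 (1), p. 264] [cite: Lang1990, Ch. 13 §4, Lemma 4.1–4.2 and sequel] -/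
theorem classicalMuVanishes_two_of_nonNorm_unit_of_sup_eq_top_of_not_dvd_discr
    (hK2 : ¬ 2 ∣ Module.finrank ℚ K) (hd : ¬ (2 : ℤ) ∣ NumberField.discr K) (hκ : κ.IsCyclotomic)
    (hs : {w : HeightOneSpectrum (𝓞 (κ.layer n)) |
        w.asIdeal.ramificationIdxIn (𝓞 (κ.layer (n + 1))) ≠ 1}.ncard ≤ 2) {x : (κ.layer (n + 1))ˣ}
    (hxE : x ∈ unitsE (κ.layer (n + 1)) ⊓ (unitsIncl (κ.layer n) (κ.layer (n + 1))).range)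
    (hxN : x ∉ (⊤ : Subgroup (κ.layer (n + 1))ˣ).map
        (Herbrand.norm (κ.layer (n + 1) ≃ₐ[κ.layer n] κ.layer (n + 1))))
    (hgen : Subgroup.closure {c : ClassGroup (𝓞 (κ.layer n)) |
        ∃ w : HeightOneSpectrum (𝓞 (κ.layer n)),
          w.asIdeal.ramificationIdxIn (𝓞 (κ.layer (n + 1))) ≠ 1 ∧
            c = ClassGroup.mk0 ⟨w.asIdeal, mem_nonZeroDivisors_of_ne_zero w.ne_bot⟩} ⊔
      (powMonoidHom 2 : ClassGroup (𝓞 (κ.layer n)) →* ClassGroup (𝓞 (κ.layer n))).range = ⊤) :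
    ClassicalMuVanishes κ :=
  classicalMuVanishes_of_eventually_const κ (c := classNumberPExp κ n) (n₀ := n)
    fun _ hm => classNumberPExp_eq_of_le_two_of_nonNorm_unit_of_sup_eq_top_of_not_dvd_discr κ n hK2 hd hκ hs hxE hxN
      hgen hm

/-- **Door UG at `2`, odd discriminant, one non-norm unit: `λ₂ = 0`** (`classicalLambda κ = 0`). [folklore]
[cite: Fukuda1994, Thm. 1 (1), p. 264 («μ_p(K/k) = λ_p(K/k) = 0»)] -/
theorem classicalLambda_eq_zero_two_of_nonNorm_unit_of_sup_eq_top_of_not_dvd_discr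
    (hK2 : ¬ 2 ∣ Module.finrank ℚ K) (hd : ¬ (2 : ℤ) ∣ NumberField.discr K) (hκ : κ.IsCyclotomic)
    (hs : {w : HeightOneSpectrum (𝓞 (κ.layer n)) |
        w.asIdeal.ramificationIdxIn (𝓞 (κ.layer (n + 1))) ≠ 1}.ncard ≤ 2) {x : (κ.layer (n + 1))ˣ}
    (hxE : x ∈ unitsE (κ.layer (n + 1)) ⊓ (unitsIncl (κ.layer n) (κ.layer (n + 1))).range)
    (hxN : x ∉ (⊤ : Subgroup (κ.layer (n + 1))ˣ).map
        (Herbrand.norm (κ.layer (n + 1) ≃ₐ[κ.layer n] κ.layer (n + 1))))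
    (hgen : Subgroup.closure {c : ClassGroup (𝓞 (κ.layer n)) |
        ∃ w : HeightOneSpectrum (𝓞 (κ.layer n)),
          w.asIdeal.ramificationIdxIn (𝓞 (κ.layer (n + 1))) ≠ 1 ∧
            c = ClassGroup.mk0 ⟨w.asIdeal, mem_nonZeroDivisors_of_ne_zero w.ne_bot⟩} ⊔
      (powMonoidHom 2 : ClassGroup (𝓞 (κ.layer n)) →* ClassGroup (𝓞 (κ.layer n))).range = ⊤) :
    classicalLambda κ = 0 :=
  classicalLambda_eq_zero_of_eventually_const κ (c := classNumberPExp κ n) (n₀ := n)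
    fun _ hm => classNumberPExp_eq_of_le_two_of_nonNorm_unit_of_sup_eq_top_of_not_dvd_discr κ n hK2 hd hκ hs hxE hxN
      hgen hm

end LayerOne

end Literature.NumberTheory.IwasawaTheory

end
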